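import Mathlib
import Summits.MatrixMultiplication.MatrixMultiplication.Theorems.SubgroupIdentityDesigns.Negative.NearFieldWitness
import Summits.MatrixMultiplication.MatrixMultiplication.Theorems.SubgroupIdentityDesigns.Negative.RegularWitness
import Summits.MatrixMultiplication.MatrixMultiplication.Theorems.SubgroupIdentityDesigns.Negative.DetFixers
import Summits.MatrixMultiplication.MatrixMultiplication.Theorems.SubgroupIdentityDesigns.Negative.SplitMonomialPlacements

/-!
# Status of the `(2,1)` cell, part two: the p-free exclusions of gen 15 in one statement

Route `LevelGradedCohnUmans`, crux `SubgroupIdentityDesigns`, the `(m,k) = (2,1)` cell.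
`WitnessStatus.levelOne_witness_status` (gen 14) records: a level-one witness at `0 < ε ≤ 1`,
`p ≥ 3` has `p ≥ 5`, three `p`-free members, and no member containing a conjugate of the Singer
cycle `C_ns` or of `O₂⁻(𝔽_p)`.  This file conjoins the further exclusions landed since, as ONE
citable theorem `levelOne_witness_status₂`: no member of a level-one witness (`-2 < ε ≤ 1`,
`p ≥ 3`) contains
* a conjugate of the Dickson near-field group `K_NF(n)` (`NearFieldWitness`);
* a subgroup of `SL₂(𝔽_p)` of order `p² - 1` (`RegularWitness`; `2T, 2O, 2I` at `p = 5, 7, 11`);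
* a central product `μ_M · K₁` of order `p² - 1`, `K₁` unimodular of exponent `∣ N`,
  `gcd(M,N) = 1`, `p ∤ N` (`RegularWitness`; the near-fields of orders `11², 23², 29², 59²`);
* a det-fixer group: a subgroup `K` and `d₀ ≠ 1` with every non-zero vector fixed by an element
  of `K` of determinant `d₀` (`DetFixers`; `O₂⁻`, `GL(2,3) < GL₂(𝔽₁₁)`, `Z·2O < GL₂(𝔽₇)`,
  `Z·2I < GL₂(𝔽₁₁)`, …);
* a conjugate of `O₂⁺(𝔽_p) = {diag(x,x⁻¹)} ∪ {unimodular antidiagonals}` together with a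
  conjugate diagonal twist `g₀`, `g₀ 0 0 * g₀ 1 1 ≠ 1` (`SplitMonomialPlacements`; every `K_Δ`,
  `|Δ| ≥ 2`, in particular `N(T)`).
By Zassenhaus' classification of the near-fields of order `p²` the second and third items together
with the Singer and near-field items cover every subgroup acting regularly on `𝔽_p² ∖ 0`; that
classification is only cited (Cameron, Permutation Groups, §1), not used: every item is a theorem
about an abstract subgroup `K` with the stated hypotheses.  At `p = 5, 7, 11` these exclusions
kill every `p`-free subgroup-TPP triple above the volume floor (exact census, kit j122243 /
j122754 — DATA, not part of this file).
VALUE = THEOREM, NOT summit progress; the crux item stmt-MatrixMultiplication-14079 is untouched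
and remains open.
-/

set_option linter.dupNamespace false

noncomputable section

open scoped BigOperators Classical

open Summit.MatrixMultiplication.MatrixMultiplication.Theorems.LieRankDesigns.Negative
  (GLm Mat budget)

open Literature.Barriers.MatrixMultiplication (SubgroupTPP)

namespace Summit.MatrixMultiplication.MatrixMultiplication.Theorems.SubgroupIdentityDesigns.Negative

section WitnessStatusTwo

variable {p : ℕ} [hp : Fact p.Prime]

/-- **Status of the `(2,1)` cell, part two.**  For a level-one witness (`SubgroupTPP`, a level-`1`
identity design, the crux inequality at exponent `2 + ε`, `-2 < ε ≤ 1`, `p ≥ 3`) and a non-square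
`n`: (1) no member contains a conjugate of the near-field group `K_NF(n)`; (2) no member contains a
unimodular subgroup of order `p² - 1`; (3) no member contains a central product `μ_M · K₁` of order
`p² - 1` (`K₁` unimodular, exponent `∣ N`, `gcd(M,N) = 1`, `p ∤ N`); (4) no member contains a
det-fixer group; (5) no member contains a conjugate of `O₂⁺(𝔽_p)` together with a conjugate
diagonal twist.  All `p`; VALUE = THEOREM, NOT summit progress. -/
theorem levelOne_witness_status₂ (hp3 : 3 ≤ p) {ε : ℝ} (hε : -2 < ε) (hε1 : ε ≤ 1)
    {H₁ H₂ H₃ : Subgroup (GLm p 2)} (htpp : SubgroupTPP H₁ H₂ H₃)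
    (hdesign : ∃ c : Mat p 2 → ℂ, (∀ M, 1 < M.rank → c M = 0) ∧
      (∑ M, c M * ZMod.stdAddChar (Matrix.trace (M * ((1 : GLm p 2) : Mat p 2)))) = 1 ∧
      ∀ a ∈ H₁, ∀ b ∈ H₂, ∀ g ∈ H₃, a * b * g ≠ 1 →
        (∑ M, c M *
          ZMod.stdAddChar (Matrix.trace (M * ((a * b * g : GLm p 2) : Mat p 2)))) = 0)
    (hwit : budget p 2 1 (2 + ε) <
      ((Nat.card H₁ * Nat.card H₂ * Nat.card H₃ : ℕ) : ℝ) ^ ((2 + ε) / 3))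
    (n : ZMod p) (hn : ∀ x : ZMod p, x * x ≠ n) :
    -- (1) near-field groups (all conjugates)
    (∀ K : Subgroup (GLm p 2),
      (∀ k ∈ K,
        (((k : GLm p 2) : Mat p 2) 0 1 = n * ((k : GLm p 2) : Mat p 2) 1 0 ∧
          ((k : GLm p 2) : Mat p 2) 1 1 = ((k : GLm p 2) : Mat p 2) 0 0 ∧
          IsSquare (((k : GLm p 2) : Mat p 2) 0 0 * ((k : GLm p 2) : Mat p 2) 0 0 -
            n * (((k : GLm p 2) : Mat p 2) 1 0 * ((k : GLm p 2) : Mat p 2) 1 0))) ∨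
        (((k : GLm p 2) : Mat p 2) 0 1 = -(n * ((k : GLm p 2) : Mat p 2) 1 0) ∧
          ((k : GLm p 2) : Mat p 2) 1 1 = -((k : GLm p 2) : Mat p 2) 0 0 ∧
          ¬ IsSquare (((k : GLm p 2) : Mat p 2) 0 0 * ((k : GLm p 2) : Mat p 2) 0 0 -
            n * (((k : GLm p 2) : Mat p 2) 1 0 * ((k : GLm p 2) : Mat p 2) 1 0)))) →
      (∀ k : GLm p 2, (k : Mat p 2) 0 1 = n * (k : Mat p 2) 1 0 →
        (k : Mat p 2) 1 1 = (k : Mat p 2) 0 0 →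
        IsSquare ((k : Mat p 2) 0 0 * (k : Mat p 2) 0 0 -
          n * ((k : Mat p 2) 1 0 * (k : Mat p 2) 1 0)) → k ∈ K) →
      (∀ k : GLm p 2, (k : Mat p 2) 0 1 = -(n * (k : Mat p 2) 1 0) →
        (k : Mat p 2) 1 1 = -(k : Mat p 2) 0 0 →
        ¬ IsSquare ((k : Mat p 2) 0 0 * (k : Mat p 2) 0 0 -
          n * ((k : Mat p 2) 1 0 * (k : Mat p 2) 1 0)) → k ∈ K) →
      ∀ x : GLm p 2, ¬ (∀ k ∈ K, x * k * x⁻¹ ∈ H₁) ∧ ¬ (∀ k ∈ K, x * k * x⁻¹ ∈ H₂) ∧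
        ¬ (∀ k ∈ K, x * k * x⁻¹ ∈ H₃)) ∧
    -- (2) unimodular subgroups of order p² - 1
    (∀ K : Subgroup (GLm p 2), (∀ k ∈ K, Matrix.det ((k : GLm p 2) : Mat p 2) = 1) →
      Nat.card K = p ^ 2 - 1 → ¬ K ≤ H₁ ∧ ¬ K ≤ H₂ ∧ ¬ K ≤ H₃) ∧
    -- (3) central products μ_M · K₁ of order p² - 1
    (∀ K : Subgroup (GLm p 2), ∀ M N : ℕ, ¬ p ∣ N → Nat.Coprime M N →
      (∀ k ∈ K, ∃ s : ZMod p, ∃ g : GLm p 2, s ^ M = 1 ∧ Matrix.det (g : Mat p 2) = 1 ∧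
        g ^ N = 1 ∧ ((k : GLm p 2) : Mat p 2) = s • (g : Mat p 2)) →
      Nat.card K = p ^ 2 - 1 → ¬ K ≤ H₁ ∧ ¬ K ≤ H₂ ∧ ¬ K ≤ H₃) ∧
    -- (4) det-fixer groups
    (∀ K : Subgroup (GLm p 2), ∀ d₀ : ZMod p, d₀ ≠ 1 →
      (∀ a : Fin 2 → ZMod p, a ≠ 0 → ∃ s ∈ K,
        ((s : GLm p 2) : Mat p 2).mulVec a = a ∧ Matrix.det ((s : GLm p 2) : Mat p 2) = d₀) →
      ¬ K ≤ H₁ ∧ ¬ K ≤ H₂ ∧ ¬ K ≤ H₃) ∧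
    -- (5) conjugates of O₂⁺ with a diagonal twist
    (∀ z g₀ : GLm p 2, (g₀ : Mat p 2) 0 1 = 0 → (g₀ : Mat p 2) 1 0 = 0 →
      (g₀ : Mat p 2) 0 0 * (g₀ : Mat p 2) 1 1 ≠ 1 →
      ¬ ((∀ y : GLm p 2, (y : Mat p 2) 0 1 = 0 → (y : Mat p 2) 1 0 = 0 →
            (y : Mat p 2) 0 0 * (y : Mat p 2) 1 1 = 1 → z * y * z⁻¹ ∈ H₁) ∧
          (∀ y : GLm p 2, (y : Mat p 2) 0 0 = 0 → (y : Mat p 2) 1 1 = 0 →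
            (y : Mat p 2) 0 1 * (y : Mat p 2) 1 0 = 1 → z * y * z⁻¹ ∈ H₁) ∧
          z * g₀ * z⁻¹ ∈ H₁) ∧
      ¬ ((∀ y : GLm p 2, (y : Mat p 2) 0 1 = 0 → (y : Mat p 2) 1 0 = 0 →
            (y : Mat p 2) 0 0 * (y : Mat p 2) 1 1 = 1 → z * y * z⁻¹ ∈ H₂) ∧
          (∀ y : GLm p 2, (y : Mat p 2) 0 0 = 0 → (y : Mat p 2) 1 1 = 0 →
            (y : Mat p 2) 0 1 * (y : Mat p 2) 1 0 = 1 → z * y * z⁻¹ ∈ H₂) ∧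
          z * g₀ * z⁻¹ ∈ H₂) ∧
      ¬ ((∀ y : GLm p 2, (y : Mat p 2) 0 1 = 0 → (y : Mat p 2) 1 0 = 0 →
            (y : Mat p 2) 0 0 * (y : Mat p 2) 1 1 = 1 → z * y * z⁻¹ ∈ H₃) ∧
          (∀ y : GLm p 2, (y : Mat p 2) 0 0 = 0 → (y : Mat p 2) 1 1 = 0 →
            (y : Mat p 2) 0 1 * (y : Mat p 2) 1 0 = 1 → z * y * z⁻¹ ∈ H₃) ∧
          z * g₀ * z⁻¹ ∈ H₃)) := by
  refine ⟨fun K hKshape hKall₁ hKall₂ x => ⟨?_, ?_, ?_⟩, fun K hKdet hKcard => ⟨?_, ?_, ?_⟩,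
    fun K M N hN hMN hK hKcard => ⟨?_, ?_, ?_⟩, fun K d₀ hd₀ hfix => ⟨?_, ?_, ?_⟩,
    fun z g₀ h01 h10 htwist => ⟨?_, ?_, ?_⟩⟩
  · exact fun hKH => no_levelOne_witness_of_nearField_member₁ hp3 hε hε1 htpp hdesign hwit n hn K
      hKshape hKall₁ hKall₂ x hKH
  · exact fun hKH => no_levelOne_witness_of_nearField_member₂ hp3 hε hε1 htpp hdesign hwit n hn K
      hKshape hKall₁ hKall₂ x hKH
  · exact fun hKH => no_levelOne_witness_of_nearField_member₃ hp3 hε hε1 htpp hdesign hwit n hn K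
      hKshape hKall₁ hKall₂ x hKH
  · exact fun hKH => no_levelOne_witness_of_unimodular_member₁ hp3 hε hε1 htpp hdesign hwit K
      hKdet hKcard hKH
  · exact fun hKH => no_levelOne_witness_of_unimodular_member₂ hp3 hε hε1 htpp hdesign hwit K
      hKdet hKcard hKH
  · exact fun hKH => no_levelOne_witness_of_unimodular_member₃ hp3 hε hε1 htpp hdesign hwit K
      hKdet hKcard hKH
  · exact fun hKH => no_levelOne_witness_of_central_unimodular_member₁ hp3 hε hε1 htpp hdesign
      hwit K hN hMN hK hKcard hKH
  · exact fun hKH => no_levelOne_witness_of_central_unimodular_member₂ hp3 hε hε1 htpp hdesign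
      hwit K hN hMN hK hKcard hKH
  · exact fun hKH => no_levelOne_witness_of_central_unimodular_member₃ hp3 hε hε1 htpp hdesign
      hwit K hN hMN hK hKcard hKH
  · exact fun hKH => no_levelOne_design_of_detFixers₁ K hKH d₀ hd₀ hfix hdesign
  · exact fun hKH => no_levelOne_design_of_detFixers₂ K hKH d₀ hd₀ hfix hdesign
  · exact fun hKH => no_levelOne_design_of_detFixers₃ K hKH d₀ hd₀ hfix hdesign
  · exact fun h => no_levelOne_design_of_splitMonomial_conj₁ z h.1 h.2.1 g₀ h.2.2 h01 h10 htwist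
      hdesign
  · exact fun h => no_levelOne_design_of_splitMonomial_conj₂ z h.1 h.2.1 g₀ h.2.2 h01 h10 htwist
      hdesign
  · exact fun h => no_levelOne_design_of_splitMonomial_conj₃ z h.1 h.2.1 g₀ h.2.2 h01 h10 htwist
      hdesign

end WitnessStatusTwo

end Summit.MatrixMultiplication.MatrixMultiplication.Theorems.SubgroupIdentityDesigns.Negative
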